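import Summits.Ventures.HSemireg.DerivedDescentBaseChange
import HarnessLib

/-!
# Road №4 (`VHCAbelianSchemesRoad`), crux stmt-HodgeConjecture-26512 — support line «sigma-descent-along-q», library item (L2), step (Q3):
# descent along an exact base-change functor for a shift-compatible natural TRANSFORMATION `τ : Φ₁ ⋙ G• ⟶ G• ⋙ Φ₂`
# (the `NatTrans` form of `Summits/Ventures/HSemireg/DerivedDescentBaseChange`, which assumes an isomorphism `τ`)

research route conditional on HC_CM; not a corollary; Q11.4-sentence-2 already refuted in dim ≥ 3.

Seat core-w5 gen 5 (width copy «width 5» of core-D; claim-free, `--supports stmt-HodgeConjecture-26512 --as helper`). HONEST FRAMING: generic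
Mathlib-level plumbing for the venture's `derivedLift` ∕ `shiftedHomMap` ∕ `mapShiftedHom` (nothing about any variety; proves NOTHING about (L2),
(U-Σ), (N-U), any registered stub, 26512, №4, HC_AV, HC_CM or HC; HC_CM HELD, by name only). It is the kernel form of the design remark of the
(Q1′) files (`Modules/SheafHomPullback`, `HodgeTheory/HomComplexPullback`, `Theorems/VHCAbelianSchemesRoadHomFunctorPullbackComparison`): the
transport of the descended endofunctors across `D(G)` needs the cochain-level comparison `τ` only as a shift-compatible natural TRANSFORMATION,
not an isomorphism — so the Hom-complex base change `𝓗om•(K, –) ⋙ q^*• ⟶ q^*• ⋙ 𝓗om•(q^*•K, –)` (whose invertibility for vector-bundle `K` is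
not in the tree) can be consumed as it stands.

SETTING (as in `DerivedDescentBaseChange`): `G : C₁ ⥤ C₂` exact between abelian categories with derived categories, endofunctors `Φ₁` of
`CochainComplex C₁ ℤ` and `Φ₂` of `CochainComplex C₂ ℤ` which (followed by `Q`) invert quasi-isomorphisms, and a natural transformation
`τ : Φ₁ ⋙ G• ⟶ G• ⋙ Φ₂`.
* §1 `derivedLiftBaseChangeHom : derivedLift Φ₁ ⋙ D(G) ⟶ D(G) ⋙ derivedLift Φ₂` (Mathlib `Localization.liftNatTrans` along `Q₁`, the two
  `Lifting` structures being the venture's `liftingBaseChange₁∕₂`), its values on `Q₁ K`, and its shift-compatibility when `Φ₁`, `Φ₂`, `τ`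
  commute with shifts (the venture's `natTrans_commShift_liftNatTrans`);
* §2 **`mapShiftedHom_shiftedHomMap_of_natTrans`** — `G_*(Φ₁_*(y)) ≫ (Q₂ τ_L)⟦n⟧' = Q₂ τ_K ≫ Φ₂_*(G_*(y))` for every
  `y : Q₁ K ⟶ (Q₁ L)⟦n⟧` (Mathlib `ShiftedHom.map_naturality` for the comparison of §1; all factorisation isomorphisms cancel) — verbatim
  the venture's `mapShiftedHom_shiftedHomMap` with `τ.hom` replaced by `τ`.

References: Mathlib `CategoryTheory.Localization.Predicate` (`liftNatTrans`, `Lifting`), `CategoryTheory.Shift.ShiftedHom` (`map_naturality`),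
`Algebra.Homology.DerivedCategory.ExactFunctor`; [cite: Weibel1994, §10.4 and Cor. 10.4.7 (localisation at quasi-isomorphisms; universal property
for natural transformations)]. Generic bookkeeping (no printed statement is typed verbatim).
-/

noncomputable section

-- implicit objects of the form `(F ⋙ G).obj X` in the factorisation isomorphisms (as in `DerivedDescentBaseChange.lean`).
set_option backward.isDefEq.respectTransparency false

open CategoryTheory CategoryTheory.Category CategoryTheory.Limits

namespace Summit.HodgeConjecture.HodgeConjecture.Ring2.SemiregularRepresentatives

set_option linter.dupNamespace false -- the cell's namespace repeats the summit name, as in every `Ring2*` file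

open Summit.Ventures.HSemireg

universe w₁ w₂ v₁ v₂ u₁ u₂

variable {C₁ : Type u₁} [Category.{v₁} C₁] [Abelian C₁] [HasDerivedCategory.{w₁} C₁]
  {C₂ : Type u₂} [Category.{v₂} C₂] [Abelian C₂] [HasDerivedCategory.{w₂} C₂]
  (G : C₁ ⥤ C₂) [G.Additive] [PreservesFiniteLimits G] [PreservesFiniteColimits G]
  (Φ₁ : CochainComplex C₁ ℤ ⥤ CochainComplex C₁ ℤ) (Φ₂ : CochainComplex C₂ ℤ ⥤ CochainComplex C₂ ℤ)
  (hΦ₁ : (HomologicalComplex.quasiIso C₁ (ComplexShape.up ℤ)).IsInvertedBy (Φ₁ ⋙ DerivedCategory.Q))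
  (hΦ₂ : (HomologicalComplex.quasiIso C₂ (ComplexShape.up ℤ)).IsInvertedBy (Φ₂ ⋙ DerivedCategory.Q))
  (τ : Φ₁ ⋙ G.mapHomologicalComplex (ComplexShape.up ℤ) ⟶ G.mapHomologicalComplex (ComplexShape.up ℤ) ⋙ Φ₂)

/-! ## §1 `derivedLift Φ₁ ⋙ D(G) ⟶ D(G) ⋙ derivedLift Φ₂` from a natural transformation -/

/-- **`derivedLift Φ₁ ⋙ D(G) ⟶ D(G) ⋙ derivedLift Φ₂`** from `τ : Φ₁ ⋙ G• ⟶ G• ⋙ Φ₂` (universal property of the localization `Q₁` for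
natural transformations, Mathlib `Localization.liftNatTrans`; the `Lifting` structures are the venture's `liftingBaseChange₁∕₂`).
[cite: Weibel1994, §10.4 and Cor. 10.4.7] -/
def derivedLiftBaseChangeHom : derivedLift Φ₁ hΦ₁ ⋙ G.mapDerivedCategory ⟶ G.mapDerivedCategory ⋙ derivedLift Φ₂ hΦ₂ :=
  Localization.liftNatTrans DerivedCategory.Q (HomologicalComplex.quasiIso C₁ (ComplexShape.up ℤ))
    ((Φ₁ ⋙ G.mapHomologicalComplex (ComplexShape.up ℤ)) ⋙ DerivedCategory.Q)
    ((G.mapHomologicalComplex (ComplexShape.up ℤ) ⋙ Φ₂) ⋙ DerivedCategory.Q) _ _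
    (Functor.whiskerRight τ DerivedCategory.Q)

/-- The comparison on `Q₁ K`: `(D(G)(Fac₁.hom_K) ≫ FacG.hom_{Φ₁K}) ≫ Q₂ τ_K ≫ (Fac₂.inv_{G•K} ≫ L₂(FacG.inv_K))`.
[cite: Weibel1994, §10.4 and Cor. 10.4.7] -/
theorem derivedLiftBaseChangeHom_app (K : CochainComplex C₁ ℤ) :
    (derivedLiftBaseChangeHom G Φ₁ Φ₂ hΦ₁ hΦ₂ τ).app (DerivedCategory.Q.obj K) =
      (G.mapDerivedCategory.map ((derivedLiftFac Φ₁ hΦ₁).hom.app K) ≫ G.mapDerivedCategoryFactors.hom.app (Φ₁.obj K)) ≫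
        DerivedCategory.Q.map (τ.app K) ≫
          ((derivedLiftFac Φ₂ hΦ₂).inv.app ((G.mapHomologicalComplex (ComplexShape.up ℤ)).obj K) ≫
            (derivedLift Φ₂ hΦ₂).map (G.mapDerivedCategoryFactors.inv.app K)) := by
  rw [derivedLiftBaseChangeHom, Localization.liftNatTrans_app, Functor.whiskerRight_app]
  change (liftingBaseChangeIso₁ G Φ₁ hΦ₁).hom.app K ≫ DerivedCategory.Q.map (τ.app K) ≫
    (liftingBaseChangeIso₂ G Φ₂ hΦ₂).inv.app K = _
  rw [liftingBaseChangeIso₁_hom_app, liftingBaseChangeIso₂_inv_app]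

/-- **The comparison commutes with shifts** when `Φ₁`, `Φ₂` and `τ` do (the venture's `natTrans_commShift_liftNatTrans`). Stated as a theorem;
consumers `haveI` it. [cite: Weibel1994, §10.4 and Cor. 10.4.7] -/
theorem derivedLiftBaseChangeHom_commShift [Φ₁.CommShift ℤ] [Φ₂.CommShift ℤ] [NatTrans.CommShift τ ℤ] :
    NatTrans.CommShift (derivedLiftBaseChangeHom G Φ₁ Φ₂ hΦ₁ hΦ₂ τ) ℤ := by
  haveI : NatTrans.CommShift (Localization.Lifting.iso DerivedCategory.Q
      (HomologicalComplex.quasiIso C₁ (ComplexShape.up ℤ))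
      ((Φ₁ ⋙ G.mapHomologicalComplex (ComplexShape.up ℤ)) ⋙ DerivedCategory.Q)
      (derivedLift Φ₁ hΦ₁ ⋙ G.mapDerivedCategory)).hom ℤ :=
    inferInstanceAs (NatTrans.CommShift (liftingBaseChangeIso₁ G Φ₁ hΦ₁).hom ℤ)
  haveI : NatTrans.CommShift (Localization.Lifting.iso DerivedCategory.Q
      (HomologicalComplex.quasiIso C₁ (ComplexShape.up ℤ))
      ((G.mapHomologicalComplex (ComplexShape.up ℤ) ⋙ Φ₂) ⋙ DerivedCategory.Q)
      (G.mapDerivedCategory ⋙ derivedLift Φ₂ hΦ₂)).hom ℤ :=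
    inferInstanceAs (NatTrans.CommShift (liftingBaseChangeIso₂ G Φ₂ hΦ₂).hom ℤ)
  exact natTrans_commShift_liftNatTrans DerivedCategory.Q (HomologicalComplex.quasiIso C₁ (ComplexShape.up ℤ)) ℤ
    ((Φ₁ ⋙ G.mapHomologicalComplex (ComplexShape.up ℤ)) ⋙ DerivedCategory.Q)
    ((G.mapHomologicalComplex (ComplexShape.up ℤ) ⋙ Φ₂) ⋙ DerivedCategory.Q)
    (derivedLift Φ₁ hΦ₁ ⋙ G.mapDerivedCategory) (G.mapDerivedCategory ⋙ derivedLift Φ₂ hΦ₂)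
    (Functor.whiskerRight τ DerivedCategory.Q)

/-! ## §2 Base change and descent commute on shifted Homs, up to the transformation `τ` -/

/-- **`G_*(Φ₁_*(y)) ≫ (Q₂ τ_L)⟦n⟧' = Q₂ τ_K ≫ Φ₂_*(G_*(y))`** for `y : Q₁ K ⟶ (Q₁ L)⟦n⟧` and a shift-compatible natural TRANSFORMATION
`τ : Φ₁ ⋙ G• ⟶ G• ⋙ Φ₂`: the descended endofunctors commute with the exact base change `G` on shifted Homs of complexes, up to `τ`
(Mathlib `ShiftedHom.map_naturality` for the shift-compatible comparison of §1, `ShiftedHom.comp_map`; all factorisation isomorphisms cancel).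
The venture's `mapShiftedHom_shiftedHomMap` is the case of an isomorphism `τ`. [cite: Weibel1994, §10.4 and Cor. 10.4.7] -/
theorem mapShiftedHom_shiftedHomMap_of_natTrans [Φ₁.CommShift ℤ] [Φ₂.CommShift ℤ] [NatTrans.CommShift τ ℤ]
    {K L : CochainComplex C₁ ℤ} {n : ℤ}
    (y : ShiftedHom (DerivedCategory.Q.obj K) (DerivedCategory.Q.obj L) n) :
    mapShiftedHom G (shiftedHomMap Φ₁ hΦ₁ y) ≫ (DerivedCategory.Q.map (τ.app L))⟦n⟧' =
      DerivedCategory.Q.map (τ.app K) ≫ shiftedHomMap Φ₂ hΦ₂ (mapShiftedHom G y) := by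
  haveI := derivedLiftBaseChangeHom_commShift G Φ₁ Φ₂ hΦ₁ hΦ₂ τ
  -- (1) both sides as sandwiches around `y.map (L₁ ⋙ D(G))` resp. `y.map (D(G) ⋙ L₂)`
  have hL : mapShiftedHom G (shiftedHomMap Φ₁ hΦ₁ y) ≫ (DerivedCategory.Q.map (τ.app L))⟦n⟧' =
      (G.mapDerivedCategoryFactors.inv.app (Φ₁.obj K) ≫ G.mapDerivedCategory.map ((derivedLiftFac Φ₁ hΦ₁).inv.app K)) ≫
        y.map (derivedLift Φ₁ hΦ₁ ⋙ G.mapDerivedCategory) ≫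
          (G.mapDerivedCategory.map ((derivedLiftFac Φ₁ hΦ₁).hom.app L) ≫
            G.mapDerivedCategoryFactors.hom.app (Φ₁.obj L) ≫ DerivedCategory.Q.map (τ.app L))⟦n⟧' := by
    simp only [mapShiftedHom, shiftedHomMap_eq, ShiftedHom.map, Functor.comp_map, Functor.commShiftIso_comp_hom_app,
      Functor.map_comp, Category.assoc]
    erw [Functor.commShiftIso_hom_naturality_assoc]
  have hR : DerivedCategory.Q.map (τ.app K) ≫ shiftedHomMap Φ₂ hΦ₂ (mapShiftedHom G y) =
      (DerivedCategory.Q.map (τ.app K) ≫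
        (derivedLiftFac Φ₂ hΦ₂).inv.app ((G.mapHomologicalComplex (ComplexShape.up ℤ)).obj K) ≫
          (derivedLift Φ₂ hΦ₂).map (G.mapDerivedCategoryFactors.inv.app K)) ≫
        y.map (G.mapDerivedCategory ⋙ derivedLift Φ₂ hΦ₂) ≫
          ((derivedLift Φ₂ hΦ₂).map (G.mapDerivedCategoryFactors.hom.app L) ≫
            (derivedLiftFac Φ₂ hΦ₂).hom.app ((G.mapHomologicalComplex (ComplexShape.up ℤ)).obj L))⟦n⟧' := by
    simp only [mapShiftedHom, shiftedHomMap_eq, ShiftedHom.map, Functor.comp_map, Functor.commShiftIso_comp_hom_app,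
      Functor.map_comp, Category.assoc]
    erw [Functor.commShiftIso_hom_naturality_assoc]
  -- (2) the naturality square of the comparison `e` of §1 on shifted Homs, raw form
  have hnat := ShiftedHom.map_naturality y (derivedLiftBaseChangeHom G Φ₁ Φ₂ hΦ₁ hΦ₂ τ)
  rw [ShiftedHom.comp_mk₀, ShiftedHom.mk₀_comp] at hnat
  -- (3) the heads and tails vs `e`
  have htail : G.mapDerivedCategory.map ((derivedLiftFac Φ₁ hΦ₁).hom.app L) ≫
      G.mapDerivedCategoryFactors.hom.app (Φ₁.obj L) ≫ DerivedCategory.Q.map (τ.app L) =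
      (derivedLiftBaseChangeHom G Φ₁ Φ₂ hΦ₁ hΦ₂ τ).app (DerivedCategory.Q.obj L) ≫
        ((derivedLift Φ₂ hΦ₂).map (G.mapDerivedCategoryFactors.hom.app L) ≫
          (derivedLiftFac Φ₂ hΦ₂).hom.app ((G.mapHomologicalComplex (ComplexShape.up ℤ)).obj L)) := by
    rw [derivedLiftBaseChangeHom_app]
    simp only [Category.assoc]
    rw [← (derivedLift Φ₂ hΦ₂).map_comp_assoc, Iso.inv_hom_id_app]
    erw [CategoryTheory.Functor.map_id, Category.id_comp, Iso.inv_hom_id_app, Category.comp_id]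
  have hhead : (G.mapDerivedCategoryFactors.inv.app (Φ₁.obj K) ≫
      G.mapDerivedCategory.map ((derivedLiftFac Φ₁ hΦ₁).inv.app K)) ≫
        (derivedLiftBaseChangeHom G Φ₁ Φ₂ hΦ₁ hΦ₂ τ).app (DerivedCategory.Q.obj K) =
      DerivedCategory.Q.map (τ.app K) ≫
        (derivedLiftFac Φ₂ hΦ₂).inv.app ((G.mapHomologicalComplex (ComplexShape.up ℤ)).obj K) ≫
          (derivedLift Φ₂ hΦ₂).map (G.mapDerivedCategoryFactors.inv.app K) := by
    rw [derivedLiftBaseChangeHom_app]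
    simp only [Category.assoc]
    rw [← G.mapDerivedCategory.map_comp_assoc, Iso.inv_hom_id_app]
    erw [CategoryTheory.Functor.map_id, Category.id_comp, Iso.inv_hom_id_app_assoc]
  -- (4) assemble
  rw [hL, hR, htail]
  simp only [Functor.map_comp, Category.assoc, reassoc_of% hnat, reassoc_of% hhead]

end Summit.HodgeConjecture.HodgeConjecture.Ring2.SemiregularRepresentatives

end
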